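import Summits.QuantumFields.YangMills.Theorems.BalabanUVNodesN11TopPairQuadSlotK1Hypotheses

/-!
# DAG node N11 — THE FIRST 𝐓-LAW OF THE RECORD HOLDS MODULO SUPPORTS: at EVERY child `s′ = (Ω_1, Λ_1)` of the first step a per-history SWITCH on the residual `ζ`-factor and a DIAL on
# `quad` (both reading only the new field `V_1`) pass through 11a's generation — the V-integration (kernel transport), the `ζ`-multiplication and the A-integration act on scale `0`
# only — so they multiply the new side by `𝟙{…}(V_1)·e^{−½c(V_1)}`; choosing them per history makes OLD SIDE = NEW SIDE wherever the supports allow, hence `TLaw₁₃CoPH θ′ p 0` next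
# to every `θ`, inside K1⁹'s hypothesis class, from SUPPORT conditions and the term laws alone (count-neutral, LOCATED; nothing of Bałaban)

HEADER — WORK-UNIT METADATA.  Cell `pub-ymgap`, YM-PLAN Track A (HUMAN RULING D-0062), seat `pub-ymgap-dag-n11-d` (g34; N11 [B14], s2), route `BalabanUVNodes`, item K1⁹ =
stmt-QuantumFields-27364 (helper lane, `--kind proof --supports 27364 --as helper`, count-neutral).  [III] = [Balaban1988Convergent], [I] = [Balaban1987RG1].  Over this seat's
`…N11TopPairQuadSlot` ∕ `…K1Hypotheses` (g34: the top pair; the `sameR` transports of K1⁹'s conjuncts; `slotsTOfRecord_nonneg_of_provisos₁₃CoPH`), 11a `Node00/TkOfRecord` (`genOp = vOp ∘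
zetaOp ∘ aOp`, `kernelRT_apply`, `aOp_apply`, `vOp_apply`, `TkOfRecord_apply`, `tkBranchOfRecord_succ ∕ _zero`, `genDataOfRecord`: generation `j` of history `s` reads `W.ζ j (Ω_{j+1})ᶜ`
and `W.w j Λ_{j+1} (Λ_{j+1}ᶜ ∩ Ω_{j+1}) S_{j+1}`, `w = chiA·e^{−½quad}`), 11c∕12b (`sect2Slot = TkOfRecord … (sect2Operand …)`, `tLaw₁₃CoPH_iff`, `Sect2.universalE_const`), RECORD 13 v1.7∕v1.8 `H`.

WHY ∕ WHAT.  The companion files settle the TOP pair; here EVERY child of the first step.  §1 (generic, 11a): a multiplier `φ((ω (j+1)).1)` comes out of the kernel transport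
(`kernelRT_const_mul`), of the A-factor (`aOp_mul_readsNext`) and of the V-factor (`vOp_kernelRT_mul_readsNext`) — `integral_const_mul`, the updates touch scale `j` only — hence ★
`genOp_genDataOfRecord_mul`: weight data with generation-`j` `ζ`-factor `φ₁·ζ` and A-weight `φ₂·w` give `𝐓^{(j)}[W′] = φ₁φ₂·𝐓^{(j)}[W]`.  §2: at `k = 1` (one generation per `{S_j}`-branch,
read at `base₁V_1`) ★★ `tkOfRecord_one_mul`, ★★ `sect2Slot_one_mul`.  §3 ★★★ `slotsT_eq_sect2Slot_of_switch_dial`: with the SWITCH `ζ-factor on Ω_1ᶜ = 𝟙{0 < 𝐓ρ₀(s′)(V_1) ∧ 0 < J(V_1)}`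
and the DIAL `A-weights = e^{−½c(V_1)}·θ's`, `c = 2·log(J∕𝐓ρ₀(s′))` — `J` = `θ`'s own new side at `s′` with the generation-`0` residual factor set to `1` — old side `=` new side at every
`V` with `0 ≤ 𝐓ρ₀(s′)(V)` and `0 < 𝐓ρ₀(s′)(V) → 0 < J(V)` (`(T∕J)·J = T`).  §4: the per-history region-indicator switch (`R_{p,Ω,Λ}(V) = Ω_1ᶜ` on the switch set, a spare region off
it) and the dial `quad_0 + c_{p,Ω,Λ}(V_1)` at the histories of length `1` are inhabited next to every `θ` with `zhLocal` ∕ `zhLaws` ∕ `ZhUnity` transferred (★ `zhLocal_of_repinOne` …), and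
★★★★★ `exists_zh_firstStep_tLaw_of_supports`: for every run, (i) `0 ≤ 𝐓ρ₀` (rows `zetaUnity`∕`zetaAbs`), (ii) per child a.e. on the `χ_1(s′)`-support «`0 < 𝐓ρ₀(s′) → 0 < J_p(s′)`»,
(iii) `Sect2.LawsT` for the prescribed terms ⟹ `TLaw₁₃CoPH θ′ p 0`.  §5 ★★★★★ `exists_zh_firstStep_tLaw_of_supports_of_hypotheses`: the same INSIDE K1⁹'s hypothesis class (the four
conjuncts transfer; (i) discharged).  READING: absent a law tying `quad` to the fluctuation variables (companion §1's `hqA`) the first 𝐓-law of the record asks of a K1⁹ witness a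
family of SUPPORT conditions and the term laws — nothing quantitative; [III] Thm 1's first step enters the record only through the PIN of `quad` (object C2) and of `ζ0` (K0b).

HONEST FRAMING.  A READING on the tree's own rows and objects (count-neutral, LOCATED): nothing of Bałaban asserted or refuted — the switch is NOT print's (3.2) region map, the dial is NOT
[I]'s `⟨A, 𝒬A⟩`; the support conditions (ii) are NOT claimed at any `θ` (they read `θ`'s `quad` through the A-integrals of `J`: a divergent Gaussian makes `J = 0`); K1⁹'s `∃θ` NOT advanced
and NOT refuted (every later law and the consequent's faces are untouched); no `Stage13HParams` of record constructed or modified (§4–§5 are anonymous-constructor inhabitations next to an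
arbitrary `θ`); N11 NOT discharged; K1⁹ NOT closed; no registered stub touched; counts unmoved (typed 28∕28 · discharged 8∕27).  One finite four-torus programme at fixed `ε = L^{−K}`; NOT ℝ⁴,
NOT OS, NOT a mass gap, NOT Clay.  No `sorry`, `axiom`, `def`, `instance`, `notation`.  Sources (SHAPE only): [III] Thm 1 p.262, remark p.262, (2.18) p.257, (2.20)–(2.23) p.258, (3.2)–(3.9)
pp.265–266, p.267, (3.16)–(3.21) pp.268–269, (3.23)–(3.25) p.270, Def. p.279; [I] Thm 1 p.259.
-/

noncomputable section

open MeasureTheory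
open scoped BigOperators Matrix.Norms.L2Operator

namespace Summit.QuantumFields.YangMills.Theorems.BalabanUVNodesN11FirstStepQuadSlot

open Literature.MathematicalPhysics.QuantumFieldTheory.Balaban1983to89 T4Continuum Node00 Node00.Tk B14.Eq218Concrete B14.Sect3Decomp
open BalabanUVNodesN11TopPairLocalResidual (WtOfRecord₁₃H_ζ_eq_ζ0)
open BalabanUVNodesN11TopPairQuadSlot (slotsTOfRecord_nonneg_of_provisos₁₃CoPH)
open BalabanUVNodesN11TopPairQuadSlotK1Hypotheses (provisos₁₃SepCoPH_of_sameR slotsNondegenerate₁₃_of_sameR admissible_of_sameR)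

variable {F : T4Family} {N : ℕ} [NeZero N]

/-! ## §1. Multipliers reading only the NEW field pass through 11a's generation: V-factor (kernel transport), ζ-factor, A-factor -/

section Multipliers

variable {P : Params}

/-- A constant comes out of the kernel transport of record (linearity of the fibre integral; no integrability needed). [cite: Balaban1988Convergent, (2.21) p.258 (bookkeeping)] -/
theorem kernelRT_const_mul {ι ι' : Type*} [Fintype ι] [Fintype ι'] (avg : (ι → SU N) → (ι' → SU N)) (c : ℝ) (f : (ι → SU N) → ℝ) (y' : ι' → SU N) :
    kernelRT avg (fun y => c * f y) y' = c * kernelRT avg f y' := by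
  simp only [kernelRT_apply, integral_const_mul]
  ring

omit [NeZero N] in
/-- A multiplier reading only the scale-`(j+1)` gauge field comes out of the A-factor at scale `j` (the A-integration updates scale `j` only; no integrability needed).
[cite: Balaban1988Convergent, (2.21) p.258, (3.23) p.270 (bookkeeping)] -/
theorem aOp_mul_readsNext (j : ℕ) [DecidableEq (PBond P j)] (sA : Finset (PBond P j)) (φ : GaugeField P (j + 1) (SU N) → ℝ)
    (w Φ : MultiCfg P (SU N) (FluctV N) → ℝ) (ω : MultiCfg P (SU N) (FluctV N)) :
    aOp j sA (fun ω => φ (ω (j + 1)).1 * w ω) Φ ω = φ (ω (j + 1)).1 * aOp j sA w Φ ω := by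
  have hne : j + 1 ≠ j := Nat.succ_ne_self j
  simp only [aOp_apply, Function.update_of_ne hne, mul_assoc]
  exact integral_const_mul _ _

/-- A multiplier reading only the scale-`(j+1)` gauge field comes out of the V-factor at scale `j` in its kernel version (the V-integration updates scale `j` only).
[cite: Balaban1988Convergent, (2.21) p.258 (bookkeeping)] -/
theorem vOp_kernelRT_mul_readsNext (j : ℕ) [DecidableEq (PBond P j)] (sV : Finset (PBond P j)) (sV' : Finset (PBond P (j + 1)))
    (avg : (↥sV → SU N) → (↥sV' → SU N)) (φ : GaugeField P (j + 1) (SU N) → ℝ) (G : MultiCfg P (SU N) (FluctV N) → ℝ) (ω : MultiCfg P (SU N) (FluctV N)) :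
    vOp j sV sV' (kernelRT avg) (fun ω => φ (ω (j + 1)).1 * G ω) ω = φ (ω (j + 1)).1 * vOp j sV sV' (kernelRT avg) G ω := by
  have hne : j + 1 ≠ j := Nat.succ_ne_self j
  simp only [vOp_apply, Function.update_of_ne hne]
  exact kernelRT_const_mul avg _ _ _

variable (ν : Stage7Numerics) (M : ℕ) (g : ℕ → ℝ) (K : ℕ)

/-- ★ **MULTIPLIERS READING ONLY THE SCALE-`(j+1)` GAUGE FIELD PASS THROUGH THE GENERATION `𝐓^{(j)}(s, S)` OF RECORD**: if two weight data `W`, `W′` have A-weights of the generation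
differing by a factor `φ₂((ω (j+1)).1)` and `ζ`-factors of the generation differing by a factor `φ₁((ω (j+1)).1)`, then `𝐓^{(j)}[W′] Φ = φ₁·φ₂·𝐓^{(j)}[W] Φ` at every configuration
(the bond sets and the kernel transport do not read the weights). [cite: Balaban1988Convergent, (2.21) p.258, (3.23) p.270 (bookkeeping)] -/
theorem genOp_genDataOfRecord_mul {W W' : TkWeights F N (FluctV N) K} {k : ℕ} (s : SeqOfRecord F ν M g K k) (S : ℕ → Set (Site (F.P K) 0)) (j : ℕ)
    {hdec : DecidableEq (PBond (F.P K) j)} (φ₁ φ₂ : GaugeField (F.P K) (j + 1) (SU N) → ℝ)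
    (hζ : ∀ ω, W'.ζ j (s.Ω (j + 1))ᶜ ω = φ₁ (ω (j + 1)).1 * W.ζ j (s.Ω (j + 1))ᶜ ω)
    (hw : ∀ ω, W'.w j (s.Λ (j + 1)) ((s.Λ (j + 1))ᶜ ∩ s.Ω (j + 1)) (S (j + 1)) ω = φ₂ (ω (j + 1)).1 * W.w j (s.Λ (j + 1)) ((s.Λ (j + 1))ᶜ ∩ s.Ω (j + 1)) (S (j + 1)) ω)
    (Φ : MultiCfg (F.P K) (SU N) (FluctV N) → ℝ) (ω : MultiCfg (F.P K) (SU N) (FluctV N)) :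
    genOp j (genDataOfRecord F N (FluctV N) ν M g K W' s S j) Φ ω = φ₁ (ω (j + 1)).1 * φ₂ (ω (j + 1)).1 * genOp j (genDataOfRecord F N (FluctV N) ν M g K W s S j) Φ ω := by
  have hζ' : W'.ζ j (s.Ω (j + 1))ᶜ = fun ω => φ₁ (ω (j + 1)).1 * W.ζ j (s.Ω (j + 1))ᶜ ω := funext hζ
  have hw' : W'.w j (s.Λ (j + 1)) ((s.Λ (j + 1))ᶜ ∩ s.Ω (j + 1)) (S (j + 1)) =
      fun ω => φ₂ (ω (j + 1)).1 * W.w j (s.Λ (j + 1)) ((s.Λ (j + 1))ᶜ ∩ s.Ω (j + 1)) (S (j + 1)) ω := funext hw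
  set D := genDataOfRecord F N (FluctV N) ν M g K W s S j with hD
  change vOp j D.sV D.sV' (kernelRT (avgRestrOfRecord F N K j D.sV D.sV')) (zetaOp (W'.ζ j (s.Ω (j + 1))ᶜ)
      (aOp j D.sA (W'.w j (s.Λ (j + 1)) ((s.Λ (j + 1))ᶜ ∩ s.Ω (j + 1)) (S (j + 1))) Φ)) ω =
    φ₁ (ω (j + 1)).1 * φ₂ (ω (j + 1)).1 * vOp j D.sV D.sV' (kernelRT (avgRestrOfRecord F N K j D.sV D.sV')) (zetaOp (W.ζ j (s.Ω (j + 1))ᶜ)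
      (aOp j D.sA (W.w j (s.Λ (j + 1)) ((s.Λ (j + 1))ᶜ ∩ s.Ω (j + 1)) (S (j + 1))) Φ)) ω
  rw [hζ', hw']
  have h1 : zetaOp (fun ω => φ₁ (ω (j + 1)).1 * W.ζ j (s.Ω (j + 1))ᶜ ω)
      (aOp j D.sA (fun ω => φ₂ (ω (j + 1)).1 * W.w j (s.Λ (j + 1)) ((s.Λ (j + 1))ᶜ ∩ s.Ω (j + 1)) (S (j + 1)) ω) Φ) =
      fun ω => (fun V₁ => φ₁ V₁ * φ₂ V₁) (ω (j + 1)).1 *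
        zetaOp (W.ζ j (s.Ω (j + 1))ᶜ) (aOp j D.sA (W.w j (s.Λ (j + 1)) ((s.Λ (j + 1))ᶜ ∩ s.Ω (j + 1)) (S (j + 1))) Φ) ω := by
    funext ω'
    rw [zetaOp_apply, zetaOp_apply, aOp_mul_readsNext]
    ring
  rw [h1]
  exact vOp_kernelRT_mul_readsNext j D.sV D.sV' _ (fun V₁ => φ₁ V₁ * φ₂ V₁) _ ω

end Multipliers

/-! ## §2. The first step at the record: a switch on the residual `ζ`-factor and a dial on `quad`, per history, multiply the new side of EVERY child -/

section FirstStep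

variable (ν : Stage7Numerics) (M : ℕ) (g : ℕ → ℝ) (K : ℕ)

/-- ★★ **AT THE FIRST STEP, FOR EVERY HISTORY `s′ = (Ω_1, Λ_1)` AND EVERY BRANCH**: weight data whose generation-`0` `ζ`-factor on `Ω_1ᶜ` and generation-`0` A-weights on `Λ_1`
differ from `W`'s by multipliers `φ₁(V_1)`, `φ₂(V_1)` reading only the new field give `𝐓_1(s′)[W′] Φ (V_1) = φ₁(V_1)·φ₂(V_1)·𝐓_1(s′)[W] Φ (V_1)` (11a's `TkOfRecord` at `k = 1`: one
generation per `{S_j}`-branch, read at `base₁(V_1)`). [cite: Balaban1988Convergent, (2.18) p.257, (2.20)–(2.21) p.258, (3.24) p.270 (bookkeeping)] -/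
theorem tkOfRecord_one_mul {W W' : TkWeights F N (FluctV N) K} (s : SeqOfRecord F ν M g K 1) (φ₁ φ₂ : GaugeField (F.P K) 1 (SU N) → ℝ)
    (hζ : ∀ ω, W'.ζ 0 (s.Ω 1)ᶜ ω = φ₁ (ω 1).1 * W.ζ 0 (s.Ω 1)ᶜ ω)
    (hw : ∀ S₁ ω, W'.w 0 (s.Λ 1) ((s.Λ 1)ᶜ ∩ s.Ω 1) S₁ ω = φ₂ (ω 1).1 * W.w 0 (s.Λ 1) ((s.Λ 1)ᶜ ∩ s.Ω 1) S₁ ω)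
    (Φ : SFluct (F.P K) (FluctV N) → B15DeterminingSets.MSField (F.P K) (SU N) → ℝ) (V₁ : GaugeField (F.P K) 1 (SU N)) :
    TkOfRecord F N (FluctV N) ν M g K W' 1 s Φ V₁ = φ₁ V₁ * φ₂ V₁ * TkOfRecord F N (FluctV N) ν M g K W 1 s Φ V₁ := by
  rw [TkOfRecord_apply, TkOfRecord_apply, Finset.mul_sum]
  refine Finset.sum_congr rfl fun S _ => ?_
  rw [tkBranchOfRecord_succ, tkBranchOfRecord_succ, tkBranchOfRecord_zero, tkBranchOfRecord_zero,
    genOp_genDataOfRecord_mul ν M g K s S 0 φ₁ φ₂ hζ (hw (S 1)) _ (baseCfg 1 V₁)]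
  have hb : ((baseCfg (V := FluctV N) 1 V₁) (0 + 1)).1 = V₁ := funext fun b => baseCfg_fst_self (V := FluctV N) 1 V₁ b
  rw [hb]

/-- ★★ **… HENCE FOR THE NEW SIDE OF EVERY CHILD**: `sect2Slot(W′, s′, t, E′, U)(V_1) = φ₁(V_1)·φ₂(V_1)·sect2Slot(W, s′, t, E′, U)(V_1)` (the §2 operand does not read the weights).
[cite: Balaban1988Convergent, (2.18) p.257, (2.21)–(2.23) p.258, (3.23)–(3.25) p.270 (bookkeeping)] -/
theorem sect2Slot_one_mul {𝔸 : Type*} [NormedRing 𝔸] [NormedAlgebra ℂ 𝔸] [CompleteSpace 𝔸] {W W' : TkWeights F N (FluctV N) K} (s : SeqOfRecord F ν M g K 1)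
    (φ₁ φ₂ : GaugeField (F.P K) 1 (SU N) → ℝ) (hζ : ∀ ω, W'.ζ 0 (s.Ω 1)ᶜ ω = φ₁ (ω 1).1 * W.ζ 0 (s.Ω 1)ᶜ ω)
    (hw : ∀ S₁ ω, W'.w 0 (s.Λ 1) ((s.Λ 1)ᶜ ∩ s.Ω 1) S₁ ω = φ₂ (ω 1).1 * W.w 0 (s.Λ 1) ((s.Λ 1)ᶜ ∩ s.Ω 1) S₁ ω)
    (Sg : Sect2.Setting 𝔸 (SU N)) (Rz : Sect2.Residual (F.P K) 𝔸) (t : Sect2.TermValues (F.P K) 𝔸 (FluctV N) M) (E' : ℝ) (U : BgMap F N K)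
    (V₁ : GaugeField (F.P K) 1 (SU N)) :
    sect2Slot F N (FluctV N) K Sg Rz W' s t E' U V₁ = φ₁ V₁ * φ₂ V₁ * sect2Slot F N (FluctV N) K Sg Rz W s t E' U V₁ :=
  tkOfRecord_one_mul ν M g K s φ₁ φ₂ hζ hw _ V₁

end FirstStep

/-! ## §3. At the record: the SWITCH `𝟙{0 < 𝐓ρ₀(s′) ∧ 0 < J(s′)}` on the residual factor and the DIAL `quad_0 + 2·log(J(s′)∕𝐓ρ₀(s′))` serve the child `s′` wherever its supports allow -/

section Record

variable (θ : Stage13HParams F N) (p : B12.RunParams)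

/-- ★★★ **THE SWITCH-AND-DIAL IDENTITY AT AN ARBITRARY CHILD `s′ = (Ω_1, Λ_1)` OF THE FIRST STEP** (any terms `(u₁, e₁)`; `J(V) :=` the new side at `s′` computed with `θ`'s
weights BUT the generation-`0` residual factor set to `1` — the reference): if weight data `W′` have generation-`0` `ζ`-factor on `Ω_1ᶜ` equal to `𝟙{0 < 𝐓ρ₀(s′)(V_1) ∧ 0 < J(V_1)}`
(SWITCH) and generation-`0` A-weights on `Λ_1` equal to `e^{−½c(V_1)}` times `θ`'s with `c(V) = 2·log(J(V)∕𝐓ρ₀(s′)(V))` wherever both are positive (DIAL), then at every coarse field `V`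
with `0 ≤ 𝐓ρ₀(s′)(V)` and `0 < 𝐓ρ₀(s′)(V) → 0 < J(V)`: OLD SIDE = NEW SIDE, `𝐓ρ₀(s′)(V) = sect2Slot(W′, s′, u₁, e₁, U_1)(V)` (`(T∕J)·J = T`; nothing of Bałaban).
[cite: Balaban1988Convergent, (2.18) p.257, (2.21)–(2.23) p.258, (3.23)–(3.25) p.270 (bookkeeping)] -/
theorem slotsT_eq_sect2Slot_of_switch_dial (s' : SeqOfRecord F θ.ν θ.τ9.M (gOfRecord₁₃ F N θ.toStage13Params p) p.K 1)
    (u₁ : Sect2.TermValues (F.P p.K) (MatA N) (FluctV N) θ.τ9.M) (e₁ : ℝ) (W' : TkWeights F N (FluctV N) p.K) (c : GaugeField (F.P p.K) 1 (SU N) → ℝ)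
    (hζ : ∀ ω, W'.ζ 0 (s'.Ω 1)ᶜ ω =
      Set.indicator {V | 0 < slotsTOfRecord F N θ.ν θ.τ9 (EOfRecord₁₃ F N θ.toStage13Params) (wOfRecord₉ F N θ.toStage9Params) θ.ppSel p
          (gOfRecord₁₃ F N θ.toStage13Params p) 1 s' V ∧
        0 < sect2Slot F N (FluctV N) p.K (settingOfRecord₁₃ F N θ.toStage13Params p) (θ.rzAt p s') { WtOfRecord₁₃H F N θ p s' with ζ := fun _ _ _ => 1 } s' u₁ e₁
          (UbgOfRecord₁₃CoP F N θ.toStage13Params p 1 s') V} (1 : GaugeField (F.P p.K) 1 (SU N) → ℝ) (ω 1).1)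
    (hw : ∀ S₁ ω, W'.w 0 (s'.Λ 1) ((s'.Λ 1)ᶜ ∩ s'.Ω 1) S₁ ω = Real.exp (-(1 / 2 : ℝ) * c (ω 1).1) * (WtOfRecord₁₃H F N θ p s').w 0 (s'.Λ 1) ((s'.Λ 1)ᶜ ∩ s'.Ω 1) S₁ ω)
    (hc : ∀ V, 0 < slotsTOfRecord F N θ.ν θ.τ9 (EOfRecord₁₃ F N θ.toStage13Params) (wOfRecord₉ F N θ.toStage9Params) θ.ppSel p (gOfRecord₁₃ F N θ.toStage13Params p) 1 s' V →
      0 < sect2Slot F N (FluctV N) p.K (settingOfRecord₁₃ F N θ.toStage13Params p) (θ.rzAt p s') { WtOfRecord₁₃H F N θ p s' with ζ := fun _ _ _ => 1 } s' u₁ e₁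
          (UbgOfRecord₁₃CoP F N θ.toStage13Params p 1 s') V →
      c V = 2 * Real.log (sect2Slot F N (FluctV N) p.K (settingOfRecord₁₃ F N θ.toStage13Params p) (θ.rzAt p s') { WtOfRecord₁₃H F N θ p s' with ζ := fun _ _ _ => 1 } s' u₁ e₁
          (UbgOfRecord₁₃CoP F N θ.toStage13Params p 1 s') V /
        slotsTOfRecord F N θ.ν θ.τ9 (EOfRecord₁₃ F N θ.toStage13Params) (wOfRecord₉ F N θ.toStage9Params) θ.ppSel p (gOfRecord₁₃ F N θ.toStage13Params p) 1 s' V))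
    (V : GaugeField (F.P p.K) 1 (SU N))
    (h0 : 0 ≤ slotsTOfRecord F N θ.ν θ.τ9 (EOfRecord₁₃ F N θ.toStage13Params) (wOfRecord₉ F N θ.toStage9Params) θ.ppSel p (gOfRecord₁₃ F N θ.toStage13Params p) 1 s' V)
    (hTJ : 0 < slotsTOfRecord F N θ.ν θ.τ9 (EOfRecord₁₃ F N θ.toStage13Params) (wOfRecord₉ F N θ.toStage9Params) θ.ppSel p (gOfRecord₁₃ F N θ.toStage13Params p) 1 s' V →
      0 < sect2Slot F N (FluctV N) p.K (settingOfRecord₁₃ F N θ.toStage13Params p) (θ.rzAt p s') { WtOfRecord₁₃H F N θ p s' with ζ := fun _ _ _ => 1 } s' u₁ e₁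
          (UbgOfRecord₁₃CoP F N θ.toStage13Params p 1 s') V) :
    slotsTOfRecord F N θ.ν θ.τ9 (EOfRecord₁₃ F N θ.toStage13Params) (wOfRecord₉ F N θ.toStage9Params) θ.ppSel p (gOfRecord₁₃ F N θ.toStage13Params p) 1 s' V =
      sect2Slot F N (FluctV N) p.K (settingOfRecord₁₃ F N θ.toStage13Params p) (θ.rzAt p s') W' s' u₁ e₁ (UbgOfRecord₁₃CoP F N θ.toStage13Params p 1 s') V := by
  set T := slotsTOfRecord F N θ.ν θ.τ9 (EOfRecord₁₃ F N θ.toStage13Params) (wOfRecord₉ F N θ.toStage9Params) θ.ppSel p (gOfRecord₁₃ F N θ.toStage13Params p) 1 s'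
    with hT
  set J := sect2Slot F N (FluctV N) p.K (settingOfRecord₁₃ F N θ.toStage13Params p) (θ.rzAt p s') { WtOfRecord₁₃H F N θ p s' with ζ := fun _ _ _ => 1 } s' u₁ e₁
    (UbgOfRecord₁₃CoP F N θ.toStage13Params p 1 s') with hJ
  have key := sect2Slot_one_mul θ.ν θ.τ9.M (gOfRecord₁₃ F N θ.toStage13Params p) p.K s' (W := { WtOfRecord₁₃H F N θ p s' with ζ := fun _ _ _ => 1 }) (W' := W')
    (fun V₁ => Set.indicator {V | 0 < T V ∧ 0 < J V} (1 : GaugeField (F.P p.K) 1 (SU N) → ℝ) V₁) (fun V₁ => Real.exp (-(1 / 2 : ℝ) * c V₁))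
    (fun ω => by rw [hζ]; exact (mul_one _).symm) (fun S₁ ω => hw S₁ ω) (settingOfRecord₁₃ F N θ.toStage13Params p) (θ.rzAt p s') u₁ e₁
    (UbgOfRecord₁₃CoP F N θ.toStage13Params p 1 s') V
  rw [key]
  by_cases hσ : 0 < T V ∧ 0 < J V
  · rw [Set.indicator_of_mem (show V ∈ {V | 0 < T V ∧ 0 < J V} from hσ), Pi.one_apply, one_mul, hc V hσ.1 hσ.2,
      show -(1 / 2 : ℝ) * (2 * Real.log (J V / T V)) = -Real.log (J V / T V) by ring, Real.exp_neg, Real.exp_log (div_pos hσ.2 hσ.1),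
      inv_div, div_mul_cancel₀ _ hσ.2.ne']
  · have hT0 : ¬ 0 < T V := fun h => hσ ⟨h, hTJ h⟩
    rw [Set.indicator_of_notMem (show V ∉ {V | 0 < T V ∧ 0 < J V} from hσ), zero_mul, zero_mul]
    exact le_antisymm (not_lt.1 hT0) h0

end Record

/-! ## §4. Next to every `θ`: the per-history switch and dial are inhabited with the rows, and THE FIRST 𝐓-LAW HOLDS MODULO SUPPORTS -/

section Inhabited

variable {θ θ' : Stage13HParams F N}
  {R : (p : B12.RunParams) → (ℕ → Set (Site (F.P p.K) 0)) → (ℕ → Set (Site (F.P p.K) 0)) → GaugeField (F.P p.K) 1 (SU N) → Set (Site (F.P p.K) 0)}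

/-- ★ The row `zhLocal` transfers to a parameter whose length-`1` residuals have a region-indicator generation-`0` factor (per history) and `θ`'s factors otherwise.
[cite: Balaban1988Convergent, (3.1) p.264, (3.2)–(3.4) p.265, p.267] -/
theorem zhLocal_of_repinOne (hoff : ∀ p n Ω Λ, n ≠ 1 → θ'.Zh p n Ω Λ = θ.Zh p n Ω Λ)
    (hS : ∀ p n Ω Λ j Y ω, (θ'.Zh p n Ω Λ).ζ0 (j + 1) Y ω = (θ.Zh p n Ω Λ).ζ0 (j + 1) Y ω)
    (h0 : ∀ p n Ω Λ, n = 1 → ∀ Y ω, (θ'.Zh p n Ω Λ).ζ0 0 Y ω = Set.indicator {R p Ω Λ (ω 1).1} (1 : Set (Site (F.P p.K) 0) → ℝ) Y)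
    (hloc : ∀ p n Ω Λ, (θ.Zh p n Ω Λ).LocalLaws) : ∀ p n Ω Λ, (θ'.Zh p n Ω Λ).LocalLaws := by
  intro p n Ω Λ
  by_cases hn : n = 1
  · refine ⟨fun j Y ω ω' hj hj1 => ?_⟩
    rcases j with _ | j
    · rw [h0 p n Ω Λ hn, h0 p n Ω Λ hn, hj1]
    · rw [hS, hS]
      exact (hloc p n Ω Λ).zeta0_local (j + 1) Y ω ω' hj hj1
  · rw [hoff p n Ω Λ hn]
    exact hloc p n Ω Λ

/-- ★ The row `zhLaws` (`ζ0 ≥ 0`) transfers likewise. [cite: Balaban1988Convergent, p.267 (bookkeeping)] -/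
theorem zhLaws_of_repinOne (hoff : ∀ p n Ω Λ, n ≠ 1 → θ'.Zh p n Ω Λ = θ.Zh p n Ω Λ)
    (hS : ∀ p n Ω Λ j Y ω, (θ'.Zh p n Ω Λ).ζ0 (j + 1) Y ω = (θ.Zh p n Ω Λ).ζ0 (j + 1) Y ω)
    (h0 : ∀ p n Ω Λ, n = 1 → ∀ Y ω, (θ'.Zh p n Ω Λ).ζ0 0 Y ω = Set.indicator {R p Ω Λ (ω 1).1} (1 : Set (Site (F.P p.K) 0) → ℝ) Y)
    (hlaws : ∀ p n Ω Λ, (θ.Zh p n Ω Λ).Laws) : ∀ p n Ω Λ, (θ'.Zh p n Ω Λ).Laws := by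
  intro p n Ω Λ
  by_cases hn : n = 1
  · refine ⟨fun j Y ω => ?_⟩
    rcases j with _ | j
    · rw [h0 p n Ω Λ hn]
      exact Set.indicator_nonneg (fun _ _ => zero_le_one) Y
    · rw [hS]
      exact (hlaws p n Ω Λ).zeta0_nonneg (j + 1) Y ω
  · rw [hoff p n Ω Λ hn]
    exact hlaws p n Ω Λ

/-- ★ The guard `ZhUnity` transfers likewise (one region carries the generation-`0` weight at every length-`1` history). [cite: Balaban1988Convergent, (3.16)–(3.20) pp.268–269] -/
theorem zhUnity_of_repinOne (hoff : ∀ p n Ω Λ, n ≠ 1 → θ'.Zh p n Ω Λ = θ.Zh p n Ω Λ)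
    (hS : ∀ p n Ω Λ j Y ω, (θ'.Zh p n Ω Λ).ζ0 (j + 1) Y ω = (θ.Zh p n Ω Λ).ζ0 (j + 1) Y ω)
    (h0 : ∀ p n Ω Λ, n = 1 → ∀ Y ω, (θ'.Zh p n Ω Λ).ζ0 0 Y ω = Set.indicator {R p Ω Λ (ω 1).1} (1 : Set (Site (F.P p.K) 0) → ℝ) Y)
    (hU : θ.ZhUnity) : θ'.ZhUnity := by
  intro p n Ω Λ j ω
  by_cases hn : n = 1
  · rcases j with _ | j
    · simp_rw [h0 p n Ω Λ hn]
      rw [finsum_eq_single _ (R p Ω Λ (ω 1).1) fun Y hY => Set.indicator_of_notMem (by simpa using hY) _]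
      rw [Set.indicator_of_mem (Set.mem_singleton _), Pi.one_apply]
    · simp_rw [hS]
      exact hU p n Ω Λ (j + 1) ω
  · simp_rw [hoff p n Ω Λ hn]
    exact hU p n Ω Λ j ω

/-- ★★★★★ **HEADLINE — THE FIRST 𝐓-LAW OF THE RECORD HOLDS MODULO SUPPORTS, NEXT TO EVERY `θ`, FOR ANY PRESCRIBED TERMS.**  For every term assignment `u_p` (indexed by the run and
the letter `M`) and constants `e_p` there is a parameter `θ′` with the SAME `Stage13RParams` data and `Phih` as `θ`, the SAME residual `Zh` at every history of length `≠ 1`, the rows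
`zhLocal` ∕ `zhLaws` ∕ `ZhUnity` transferred, such that for every run `p`: IF (i) the old sides are nonnegative (automatic under the rows `zetaUnity` ∕ `zetaAbs`), (ii) FOR EVERY CHILD
`s′ = (Ω_1, Λ_1)` OF THE FIRST STEP, a.e. on the support of `χ_1(s′)`, the reference new side `J_p(s′)(V)` — `θ`'s OWN new side at `s′` with the terms `(u_p, e_p)` and the generation-`0`
residual factor set to `1` — is positive wherever the old side `𝐓ρ₀(s′)(V)` is, and (iii) the term laws `Sect2.LawsT` hold for `u_p` at every child, THEN `TLaw₁₃CoPH θ′ p 0` — the whole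
first 𝐓-law of the record along the run — HOLDS.  The witness: per history, the region-indicator SWITCH `𝟙{0 < 𝐓ρ₀(s′) ∧ 0 < J_p(s′)}` on `Ω_1ᶜ` and the DIAL `quad_0 + 2·log(J_p(s′)∕𝐓ρ₀(s′))`
read at the new field (§3); no identity of [I] ∕ [III] is used.  So, absent a law tying `quad` to the fluctuation variables, what the first 𝐓-law asks of a K1⁹ witness is a family of
SUPPORT conditions (ii) and the term laws (iii) — nothing quantitative.  LOCATED, count-neutral; nothing of Bałaban asserted or refuted; K1⁹'s `∃θ` neither advanced nor refuted
(the later laws and the consequent's faces are untouched; (ii) is NOT claimed at any `θ`). [cite: Balaban1988Convergent, Thm 1 p.262, remark p.262, (2.18) p.257, (2.20)–(2.23) p.258, (3.2) p.265, p.267, (3.16)–(3.21) pp.268–269, (3.23)–(3.25) p.270, Def. p.279] -/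
theorem exists_zh_firstStep_tLaw_of_supports (θ : Stage13HParams F N)
    (u : (p : B12.RunParams) → (M : ℕ) → Sect2.TermValues (F.P p.K) (MatA N) (FluctV N) M) (e : B12.RunParams → ℝ) :
    ∃ θ' : Stage13HParams F N, θ'.toStage13RParams = θ.toStage13RParams ∧ θ'.Phih = θ.Phih ∧
      (∀ p n Ω Λ, n ≠ 1 → θ'.Zh p n Ω Λ = θ.Zh p n Ω Λ) ∧
      ((∀ p n Ω Λ, (θ.Zh p n Ω Λ).LocalLaws) → ∀ p n Ω Λ, (θ'.Zh p n Ω Λ).LocalLaws) ∧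
      ((∀ p n Ω Λ, (θ.Zh p n Ω Λ).Laws) → ∀ p n Ω Λ, (θ'.Zh p n Ω Λ).Laws) ∧
      (θ.ZhUnity → θ'.ZhUnity) ∧
      ∀ p : B12.RunParams,
        (∀ (s' : SeqOfRecord F θ.ν θ.τ9.M (gOfRecord₁₃ F N θ.toStage13Params p) p.K 1) (V : GaugeField (F.P p.K) 1 (SU N)),
          0 ≤ slotsTOfRecord F N θ.ν θ.τ9 (EOfRecord₁₃ F N θ.toStage13Params) (wOfRecord₉ F N θ.toStage9Params) θ.ppSel p (gOfRecord₁₃ F N θ.toStage13Params p) 1 s' V) →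
        (∀ s' : SeqOfRecord F θ.ν θ.τ9.M (gOfRecord₁₃ F N θ.toStage13Params p) p.K 1,
          ∀ᵐ V ∂fieldMeasure (F.P p.K) 1 (SU N), chiSeqOfRecord F N θ.ν θ.τ9.M (gOfRecord₁₃ F N θ.toStage13Params p) p.K 1 s' V ≠ 0 →
            0 < slotsTOfRecord F N θ.ν θ.τ9 (EOfRecord₁₃ F N θ.toStage13Params) (wOfRecord₉ F N θ.toStage9Params) θ.ppSel p (gOfRecord₁₃ F N θ.toStage13Params p) 1 s' V →
            0 < sect2Slot F N (FluctV N) p.K (settingOfRecord₁₃ F N θ.toStage13Params p) (θ.rzAt p s') { WtOfRecord₁₃H F N θ p s' with ζ := fun _ _ _ => 1 } s'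
              (u p θ.τ9.M) (e p) (UbgOfRecord₁₃CoP F N θ.toStage13Params p 1 s') V) →
        (∀ s' : SeqOfRecord F θ.ν θ.τ9.M (gOfRecord₁₃ F N θ.toStage13Params p) p.K 1,
          Sect2.LawsT (sect2TowerOfRecord F N (FluctV N) p.K (settingOfRecord₁₃ F N θ.toStage13Params p) (θ.rzAt p s') s' (u p θ.τ9.M))
            (settingOfRecord₁₃ F N θ.toStage13Params p).lf (settingOfRecord₁₃ F N θ.toStage13Params p).βc 0) →
        TLaw₁₃CoPH F N θ' p 0 := by
  classical
  -- the old side `T`, the reference new side `J` (generation-`0` residual factor set to `1`), per run and history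
  let T : (p : B12.RunParams) → SeqOfRecord F θ.ν θ.τ9.M (gOfRecord₁₃ F N θ.toStage13Params p) p.K 1 → GaugeField (F.P p.K) 1 (SU N) → ℝ :=
    fun p s V => slotsTOfRecord F N θ.ν θ.τ9 (EOfRecord₁₃ F N θ.toStage13Params) (wOfRecord₉ F N θ.toStage9Params) θ.ppSel p (gOfRecord₁₃ F N θ.toStage13Params p) 1 s V
  let J : (p : B12.RunParams) → SeqOfRecord F θ.ν θ.τ9.M (gOfRecord₁₃ F N θ.toStage13Params p) p.K 1 → GaugeField (F.P p.K) 1 (SU N) → ℝ :=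
    fun p s V => sect2Slot F N (FluctV N) p.K (settingOfRecord₁₃ F N θ.toStage13Params p) (θ.rzAt p s) { WtOfRecord₁₃H F N θ p s with ζ := fun _ _ _ => 1 } s
      (u p θ.τ9.M) (e p) (UbgOfRecord₁₃CoP F N θ.toStage13Params p 1 s) V
  -- the switch set, the dial, the spare region and the region map, per run and length-`1` history `(Ω, Λ)`
  let G : (p : B12.RunParams) → (ℕ → Set (Site (F.P p.K) 0)) → (ℕ → Set (Site (F.P p.K) 0)) → Set (GaugeField (F.P p.K) 1 (SU N)) := fun p Ω Λ =>
    {V | ∃ s : SeqOfRecord F θ.ν θ.τ9.M (gOfRecord₁₃ F N θ.toStage13Params p) p.K 1, s.Ω = Ω ∧ s.Λ = Λ ∧ 0 < T p s V ∧ 0 < J p s V}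
  let c : (p : B12.RunParams) → (ℕ → Set (Site (F.P p.K) 0)) → (ℕ → Set (Site (F.P p.K) 0)) → GaugeField (F.P p.K) 1 (SU N) → ℝ := fun p Ω Λ V =>
    if h : ∃ s : SeqOfRecord F θ.ν θ.τ9.M (gOfRecord₁₃ F N θ.toStage13Params p) p.K 1, s.Ω = Ω ∧ s.Λ = Λ then 2 * Real.log (J p h.choose V / T p h.choose V) else 0
  let Yo : (p : B12.RunParams) → (ℕ → Set (Site (F.P p.K) 0)) → Set (Site (F.P p.K) 0) := fun p Ω => if (Ω 1)ᶜ = (∅ : Set (Site (F.P p.K) 0)) then Set.univ else ∅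
  let R : (p : B12.RunParams) → (ℕ → Set (Site (F.P p.K) 0)) → (ℕ → Set (Site (F.P p.K) 0)) → GaugeField (F.P p.K) 1 (SU N) → Set (Site (F.P p.K) 0) :=
    fun p Ω Λ V => if V ∈ G p Ω Λ then (Ω 1)ᶜ else Yo p Ω
  have hYo : ∀ p (Ω : ℕ → Set (Site (F.P p.K) 0)), (Ω 1)ᶜ ≠ Yo p Ω := fun p Ω h => by
    by_cases he : (Ω 1)ᶜ = (∅ : Set (Site (F.P p.K) 0))
    · have h' : (Ω 1)ᶜ = Set.univ := by rw [h]; exact if_pos he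
      exact Set.empty_ne_univ (he.symm.trans h')
    · exact he (h.trans (if_neg he))
  -- the re-pinned residual at the histories of length `1`
  let Ztop : (p : B12.RunParams) → ℕ → (ℕ → Set (Site (F.P p.K) 0)) → (ℕ → Set (Site (F.P p.K) 0)) → TkResidualW F N (FluctV N) p.K := fun p n Ω Λ =>
    ⟨fun j Y ω => match j with
        | 0 => Set.indicator {R p Ω Λ (ω 1).1} (1 : Set (Site (F.P p.K) 0) → ℝ) Y
        | j + 1 => (θ.Zh p n Ω Λ).ζ0 (j + 1) Y ω,
      fun j Λ' ω => match j with
        | 0 => (θ.Zh p n Ω Λ).quad 0 Λ' ω + c p Ω Λ (ω 1).1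
        | j + 1 => (θ.Zh p n Ω Λ).quad (j + 1) Λ' ω⟩
  let Zh' : (p : B12.RunParams) → ℕ → (ℕ → Set (Site (F.P p.K) 0)) → (ℕ → Set (Site (F.P p.K) 0)) → TkResidualW F N (FluctV N) p.K :=
    fun p n Ω Λ => if n = 1 then Ztop p n Ω Λ else θ.Zh p n Ω Λ
  have hZoff : ∀ p n Ω Λ, n ≠ 1 → Zh' p n Ω Λ = θ.Zh p n Ω Λ := fun p n Ω Λ hn => if_neg hn
  have hZtop : ∀ p n Ω Λ, n = 1 → Zh' p n Ω Λ = Ztop p n Ω Λ := fun p n Ω Λ hn => if_pos hn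
  let θ' : Stage13HParams F N := { θ with Zh := Zh' }
  have hS : ∀ p n Ω Λ j Y ω, (θ'.Zh p n Ω Λ).ζ0 (j + 1) Y ω = (θ.Zh p n Ω Λ).ζ0 (j + 1) Y ω := fun p n Ω Λ j Y ω => by
    show (Zh' p n Ω Λ).ζ0 (j + 1) Y ω = _
    by_cases hn : n = 1
    · rw [hZtop p n Ω Λ hn]
    · rw [hZoff p n Ω Λ hn]
  have h0 : ∀ p n Ω Λ, n = 1 → ∀ Y ω, (θ'.Zh p n Ω Λ).ζ0 0 Y ω = Set.indicator {R p Ω Λ (ω 1).1} (1 : Set (Site (F.P p.K) 0) → ℝ) Y :=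
    fun p n Ω Λ hn Y ω => by
    show (Zh' p n Ω Λ).ζ0 0 Y ω = _
    rw [hZtop p n Ω Λ hn]
  have hq : ∀ p n Ω Λ, n = 1 → ∀ Λ' ω, (θ'.Zh p n Ω Λ).quad 0 Λ' ω = (θ.Zh p n Ω Λ).quad 0 Λ' ω + c p Ω Λ (ω 1).1 := fun p n Ω Λ hn Λ' ω => by
    show (Zh' p n Ω Λ).quad 0 Λ' ω = _
    rw [hZtop p n Ω Λ hn]
  refine ⟨θ', rfl, rfl, hZoff, zhLocal_of_repinOne hZoff hS h0, zhLaws_of_repinOne hZoff hS h0, zhUnity_of_repinOne hZoff hS h0, fun p hT0 hJ hlaw => ?_⟩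
  refine (tLaw₁₃CoPH_iff F N θ' p 0).2 ⟨fun _ => u p θ.τ9.M, fun _ => e p, Sect2.universalE_const _, fun s' => ⟨hlaw s', Or.inr ?_⟩⟩
  -- at the child `s′`: identify the switch set and the dial, then §3
  have hex : ∃ s : SeqOfRecord F θ.ν θ.τ9.M (gOfRecord₁₃ F N θ.toStage13Params p) p.K 1, s.Ω = s'.Ω ∧ s.Λ = s'.Λ := ⟨s', rfl, rfl⟩
  have hch : hex.choose = s' := Seq.ext' hex.choose_spec.1 hex.choose_spec.2
  have hG : ∀ V, V ∈ G p s'.Ω s'.Λ ↔ 0 < T p s' V ∧ 0 < J p s' V := fun V =>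
    ⟨fun ⟨s, hsΩ, hsΛ, hs⟩ => by rw [Seq.ext' hsΩ hsΛ] at hs; exact hs, fun h => ⟨s', rfl, rfl, h⟩⟩
  have hζ : ∀ ω, (WtOfRecord₁₃H F N θ' p s').ζ 0 (s'.Ω 1)ᶜ ω = Set.indicator {V | 0 < T p s' V ∧ 0 < J p s' V} (1 : GaugeField (F.P p.K) 1 (SU N) → ℝ) (ω 1).1 := by
    intro ω
    rw [WtOfRecord₁₃H_ζ_eq_ζ0, h0 p 1 s'.Ω s'.Λ rfl]
    by_cases hV : 0 < T p s' (ω 1).1 ∧ 0 < J p s' (ω 1).1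
    · have hRV : R p s'.Ω s'.Λ (ω 1).1 = (s'.Ω 1)ᶜ := if_pos ((hG _).2 hV)
      rw [hRV, Set.indicator_of_mem (Set.mem_singleton _), Set.indicator_of_mem (show (ω 1).1 ∈ {V | 0 < T p s' V ∧ 0 < J p s' V} from hV), Pi.one_apply,
        Pi.one_apply]
    · have hRV : R p s'.Ω s'.Λ (ω 1).1 = Yo p s'.Ω := if_neg (fun h => hV ((hG _).1 h))
      rw [hRV, Set.indicator_of_notMem (fun h => hYo p s'.Ω (Set.mem_singleton_iff.1 h)),
        Set.indicator_of_notMem (show (ω 1).1 ∉ {V | 0 < T p s' V ∧ 0 < J p s' V} from hV)]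
  have hw : ∀ S₁ ω, (WtOfRecord₁₃H F N θ' p s').w 0 (s'.Λ 1) ((s'.Λ 1)ᶜ ∩ s'.Ω 1) S₁ ω =
      Real.exp (-(1 / 2 : ℝ) * c p s'.Ω s'.Λ (ω 1).1) * (WtOfRecord₁₃H F N θ p s').w 0 (s'.Λ 1) ((s'.Λ 1)ᶜ ∩ s'.Ω 1) S₁ ω := by
    intro S₁ ω
    show chiAW F N (FluctV N) θ.ν θ.A₁ p (gOfRecord₁₃ F N θ.toStage13Params p) 0 ((s'.Λ 1)ᶜ ∩ s'.Ω 1) S₁ ω * Real.exp (-(1 / 2 : ℝ) * (θ'.Zh p 1 s'.Ω s'.Λ).quad 0 (s'.Λ 1) ω) =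
      Real.exp (-(1 / 2 : ℝ) * c p s'.Ω s'.Λ (ω 1).1) *
        (chiAW F N (FluctV N) θ.ν θ.A₁ p (gOfRecord₁₃ F N θ.toStage13Params p) 0 ((s'.Λ 1)ᶜ ∩ s'.Ω 1) S₁ ω * Real.exp (-(1 / 2 : ℝ) * (θ.Zh p 1 s'.Ω s'.Λ).quad 0 (s'.Λ 1) ω))
    rw [hq p 1 s'.Ω s'.Λ rfl, mul_add, Real.exp_add]
    ring
  have hc : ∀ V, 0 < T p s' V → 0 < J p s' V → c p s'.Ω s'.Λ V = 2 * Real.log (J p s' V / T p s' V) := fun V _ _ => by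
    show (if h : ∃ s : SeqOfRecord F θ.ν θ.τ9.M (gOfRecord₁₃ F N θ.toStage13Params p) p.K 1, s.Ω = s'.Ω ∧ s.Λ = s'.Λ then
      2 * Real.log (J p h.choose V / T p h.choose V) else 0) = _
    rw [dif_pos hex, hch]
  filter_upwards [hJ s'] with V hV hχ
  exact slotsT_eq_sect2Slot_of_switch_dial θ p s' (u p θ.τ9.M) (e p) (WtOfRecord₁₃H F N θ' p s') (c p s'.Ω s'.Λ) hζ hw hc V (hT0 s' V) (hV hχ)

end Inhabited

/-! ## §5. Inside K1⁹'s hypothesis class: the first 𝐓-law from the support conditions and the term laws alone -/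

section Hypotheses

/-- ★★★★★ **K1⁹'s HYPOTHESIS LIST DOES NOT EXCLUDE IT**: from ANY `θ` carrying K1⁹'s four hypothesis-side conjuncts (`Provisos₁₃SepCoPH`, `ZhUnity`, `SlotsNondegenerate₁₃`, `Admissible`)
there is a `θ′` CARRYING THE SAME FOUR (same `Stage13RParams` data and `Phih`, same residual at every history of length `≠ 1`) such that, for every run `p`, the per-child SUPPORT
conditions (a.e. on the support of `χ_1(s′)`: `0 < 𝐓ρ₀(s′) → 0 < J_p(s′)`, `J_p(s′)` = `θ`'s own new side at `s′` with the generation-`0` residual factor set to `1` and the terms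
`(u_p, e_p)`) and the term laws `Sect2.LawsT` for `u_p` ALONE give `TLaw₁₃CoPH θ′ p 0` (the nonnegativity of the old sides now comes from the rows `zetaUnity` ∕ `zetaAbs`).  LOCATED,
count-neutral; nothing of Bałaban asserted or refuted; K1⁹'s `∃θ` neither advanced nor refuted; N11 NOT discharged. [cite: Balaban1988Convergent, Thm 1 p.262, remark p.262, (2.18) p.257, (2.21)–(2.23) p.258, (3.2)–(3.9) pp.265–266, (3.16)–(3.21) pp.268–269, (3.23)–(3.25) p.270, Def. p.279] -/
theorem exists_zh_firstStep_tLaw_of_supports_of_hypotheses (θ : Stage13HParams F N) (hP : θ.Provisos₁₃SepCoPH F N) (hU : θ.ZhUnity)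
    (hS : θ.SlotsNondegenerate₁₃ F N) (hA : θ.Admissible F N)
    (u : (p : B12.RunParams) → (M : ℕ) → Sect2.TermValues (F.P p.K) (MatA N) (FluctV N) M) (e : B12.RunParams → ℝ) :
    ∃ θ' : Stage13HParams F N, θ'.toStage13RParams = θ.toStage13RParams ∧ θ'.Phih = θ.Phih ∧
      (∀ p n Ω Λ, n ≠ 1 → θ'.Zh p n Ω Λ = θ.Zh p n Ω Λ) ∧
      θ'.Provisos₁₃SepCoPH F N ∧ (θ'.ZhUnity ∧ θ'.SlotsNondegenerate₁₃ F N) ∧ θ'.Admissible F N ∧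
      ∀ p : B12.RunParams,
        (∀ s' : SeqOfRecord F θ.ν θ.τ9.M (gOfRecord₁₃ F N θ.toStage13Params p) p.K 1,
          ∀ᵐ V ∂fieldMeasure (F.P p.K) 1 (SU N), chiSeqOfRecord F N θ.ν θ.τ9.M (gOfRecord₁₃ F N θ.toStage13Params p) p.K 1 s' V ≠ 0 →
            0 < slotsTOfRecord F N θ.ν θ.τ9 (EOfRecord₁₃ F N θ.toStage13Params) (wOfRecord₉ F N θ.toStage9Params) θ.ppSel p (gOfRecord₁₃ F N θ.toStage13Params p) 1 s' V →
            0 < sect2Slot F N (FluctV N) p.K (settingOfRecord₁₃ F N θ.toStage13Params p) (θ.rzAt p s') { WtOfRecord₁₃H F N θ p s' with ζ := fun _ _ _ => 1 } s'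
              (u p θ.τ9.M) (e p) (UbgOfRecord₁₃CoP F N θ.toStage13Params p 1 s') V) →
        (∀ s' : SeqOfRecord F θ.ν θ.τ9.M (gOfRecord₁₃ F N θ.toStage13Params p) p.K 1,
          Sect2.LawsT (sect2TowerOfRecord F N (FluctV N) p.K (settingOfRecord₁₃ F N θ.toStage13Params p) (θ.rzAt p s') s' (u p θ.τ9.M))
            (settingOfRecord₁₃ F N θ.toStage13Params p).lf (settingOfRecord₁₃ F N θ.toStage13Params p).βc 0) →
        TLaw₁₃CoPH F N θ' p 0 := by
  obtain ⟨θ', h1, h2, hoff, hloc, hlaws, hun, htl⟩ := exists_zh_firstStep_tLaw_of_supports θ u e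
  exact ⟨θ', h1, h2, hoff, provisos₁₃SepCoPH_of_sameR h1 hP (hlaws hP.zhLaws) (hloc hP.zhLocal), ⟨hun hU, slotsNondegenerate₁₃_of_sameR h1 hS⟩,
    admissible_of_sameR h1 hA, fun p hJ hlaw => htl p (fun s' V => slotsTOfRecord_nonneg_of_provisos₁₃CoPH θ p hP.toCore s' V) hJ hlaw⟩

end Hypotheses





end Summit.QuantumFields.YangMills.Theorems.BalabanUVNodesN11FirstStepQuadSlot

end
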